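import Summits.QuantumFields.YangMills.Theorems.UnitScaleTiltProp7KinvEtaFamilyPackage
import Summits.QuantumFields.YangMills.Theorems.UnitScaleTiltProp7KinvSlotOfCone
import Summits.QuantumFields.YangMills.Theorems.UnitScaleTiltProp7H133FamilyPackage
import Summits.QuantumFields.YangMills.Theorems.UnitScaleTiltProp7GreenEtaTJBlockDecayOfLetters
import Summits.QuantumFields.YangMills.Theorems.UnitScaleTiltProp7TJRowsFamilyOfH133
import Summits.QuantumFields.YangMills.Theorems.UnitScaleTiltProp7CoerciveDeltaOnePJOfTJSupRow
import Summits.QuantumFields.YangMills.Theorems.UnitScaleTiltProp7OneFormGreenBlockSupFamily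
import Summits.QuantumFields.YangMills.Theorems.UnitScaleTiltProp7GreenPiBlockLettersEdition
import HarnessLib

/-!
# Route `UnitScaleTilt`, crux K1 «MinimiserStabilityRegPr» (stmt-QuantumFields-19200), EX face — K-STOREY, FILE (K6-J = THE J-SLOT CLOSURE KNIT):
# **THE COARSE ENTRY ROW `hKinv`(S_J) OF `K_J⁻¹ = (Q_kG_SQ_k†)⁻¹`, `S_J := Δ^η + T_Jᴾ` (S47's slot of rows (7) `hCk` and (8) `h137kΔ`), FOR ALL MEMBERS, AS ONE `∃`-PACKAGE** —
# the slot-generic cone ✓`Prop7KinvSlotOfCone.kinvRow_slot_family_of_cone` at `Δx L i := DeltaEtaSlot … + TJSlotP … (a L i)` fed: the η-closure ✓`Prop7KinvEtaFamilyPackage.kinvRow_eta_family_exists`,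
# the chair's (F) ✓`Prop7GreenEtaTJBlockDecayOfLetters.hDelta_etaTJ_of_letters` (the block rows of `G_S − G₀` from the weighted `G₀`-value letter and the weighted `T_J`-value letter),
# the `G₀` block-sup family ✓`Prop7OneFormGreenBlockSupFamily.blockSup_GT_DeltaEtaSlot_family` (weighted by ✓`weighted_of_blockSupported`), px12's (T1) ✓`Prop7TJRowsFamilyOfH133.tjValueRows_family_of_h133`
# (the sup row of `T_Jᴾ`, LINEAR in the radius, from `h133`) ∘ ✓`Prop7H133FamilyPackage.h133_family_exists`, weighted by px19's ✓`Prop7TJWeightedRowsOfUnweighted.hTw_of_supRow`,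
# px12's (T2) ✓`Prop7CoerciveDeltaOnePJOfTJSupRow.hco_DeltaEtaTJ_exists_of_tjSupLin` (the class `PosOnto`(S_J)), and (γ) ✓`hco_DeltaEtaSlot_exists` (the class `PosOnto`(Δ^η))

Cell `ym3-torus` (HUMAN RULING D-0037; rung R3 = SU(2) YM₃ on T³ — NOT d = 4, NOT infinite volume, NOT a mass gap, NOT Clay).  Width seat `ym3-torus-px10` (gen 14; FREE px; CLAIM
2026-08-30 14:01Z, ★p1 g28 CHAIR LOCATE №45).  THEOREMS ONLY (0 `def`, 0 `sorry`, default heartbeats); `--supports stmt-QuantumFields-19200 --as helper`; count-neutral.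

THE PRINT.  [Balaban1985BackgroundPropagators] p. 421 (3.127)–(3.131): the operator `Δ₁ = Δ^η + T_J` differs from `Δ^η` by the J-term operators, *«small because the configuration
`J` is small»*; (3.132) p. 422: the coarse operator `(Q G Q*)⁻¹` has an exponentially decaying kernel; the cone (PARTS A∕B∕B′) transports that row from `G₀` to `G_S` through the block rows
of `G_S − G₀ = −G₀T_JG_S` (second resolvent identity, (F)), whose constant is `O(α)` because `‖T_J‖ = O(α)` ((3.137) p. 423 with [Balaban1985Variational] (28) p. 282 `|J| ≤ C·ε₁`).

WHAT IS PROVED (ns `Summit.QuantumFields.YangMills.Theorems.Prop7KinvEtaTJFamilyPackage`).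
* §1 ★★ `hDelta_etaTJ_of_blockLetter_of_supRow` — MEMBER: the cone's `hΔb` text at `Δx := DeltaEtaSlot … + TJSlotP … a` from the BLOCK-SUPPORTED `G₀`-value letter (rate `δ₁`,
  constant `BV`) and the SUP ROW of `T_Jᴾ` (constant `k`), at any rate `δ ≥ 0` with `δ + ν ≤ δ₁`, in the window `BV·(2(1+1∕ν))³·(k·e^{δ}) ≤ ½`; constant
  `κ := 2·(BV·V)·(BV·V)·(k·e^{δ})`, `V := (2(1+1∕ν))³` — (F) ∘ ✓`weighted_of_blockSupported` ∘ ✓`hTw_of_supRow`.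
* §2 ★★★ `kinvRow_etaTJ_family_exists` — THERE ARE L-only `αJ CJ μJ : ℕ → ℝ` (cap with the three windows of record and `≤ 1`, constant `≥ 0`, rate `> 0`) such that for every `L > 1`,
  member `i`, background `U₀` with `RegPr ρ U₀`, `ρ ≤ αJ L`, under `Lift`, `ROOM` and the coupling window `a₀(c₀ L∕cB L)ℓ³ ≤ a ≤ a₁(c₀ L∕cB L)ℓ³`: THE DOORS' `hKinv` TEXT AT THE SLOT
  `S_J` — `‖toL2B⁻¹(KinvT … a (DeltaEtaSlot … + TJSlotP … a) U₀ (toL2B δ_yZ))(y′)‖ ≤ CJ L·((c₀ L∕cB L)·ℓ³)·e^{−μJ L·tdist(ŷ′, ŷ)}·‖Z‖`, the `hKinv` input of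
  ✓`Prop7KernelCDoorOfKinvEntry.kernelC_family_of_kinvRow_of_greenColumn` (row (7)) and ✓`Prop7Kernel137DoorOfKinvEntry.kernel137_family_of_kinvRow` (row (8)) — NO letter displayed.
  CHOICES (pure reals): `δ := δG∕2` (ν := δG∕2), `μ := min μK (δG∕4)` (so `2μ ≤ δ`), `k := αJ·MT` (T1's sup row is linear in the radius, read at the cap), `V := (2(1+2∕δG))³`,
  `N := 2·(BV·V)·(MT·e^{δ})`, cone modulus `M := CK·9600e^{2μ+1}·(2(BV·V)²·MT·e^{δ})·(2(1+1∕μ))³·3(2(1+2∕μ))³·3(2(1+4∕μ))³`, cap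
  `αJ := min (min (min αK αG) (min αco αc)) (min (M+1)⁻¹ (N+1)⁻¹)` — so (F)'s window reads `αJ·N∕2 ≤ ½` and the cone's `αJ·M < 1`.  As in K6-η∕K6-Π the doors take a coupling
  FUNCTION, so they are run on the CLAMPED function `(L′, i′) ↦ max (a₀t′) (min a (a₁t′))` with the thread `Lift ∧ ROOM`.
HONEST SCOPE.  An `∃`-assembly over landed doors; no estimate of print is proved HERE; ROOM enters through `hKinv`(η) (the η-interpolant's wrap room) and through `h133`; nothing of rows
(7)(8), EX or the crux is proved; the Yang–Mills mass gap is NOT proved.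

References: T. Bałaban, CMP **99** (1985) 389–434 [Balaban1985BackgroundPropagators] ((3.127)–(3.132) pp.421–422, (3.137) p.423, (3.86) p.409, Thm 3.12 p.423); CMP **102** (1985)
277–309 [Balaban1985Variational] (Thm 1 p.279, (28) p.282, (110)–(111) p.294).
-/

set_option autoImplicit false

noncomputable section

open scoped BigOperators Matrix.Norms.L2Operator InnerProductSpace ComplexConjugate

namespace Summit.QuantumFields.YangMills.Theorems.Prop7KinvEtaTJFamilyPackage

open Literature.MathematicalPhysics.QuantumFieldTheory.Balaban1983to89
open Literature.MathematicalPhysics.QuantumFieldTheory.Balaban1983to89.T3ContinuumYM3Torus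
open Literature.MathematicalPhysics.QuantumFieldTheory.Balaban1983to89.T3Thm1Carrier
open T3PrintedRegularMinimiser (RegPr)
open T3PrintedMinimiserExistence (regPr_mono)
open T3PrintedRegularOrbits (sites_eq)
open T3LevelShift (siteShift)
open T3SectALandauChart (bgUnits)
open B15DeterminingSets (embIter)
open B9Eq311L2Pairing (WL2)
open B11Eq103H1Complex (BondL2K)
open B5Eq118OneStroke (iterBlockOf)
open Summit.QuantumFields.YangMills.Theorems.Prop8Chart (emlIterU)
open Summit.QuantumFields.YangMills.Theorems.Prop7SectET3Transport (periodsT3)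
open Summit.QuantumFields.YangMills.Theorems.Prop7SectET3HilbertLetters (W₂ toL2 toL2B)
open Summit.QuantumFields.YangMills.Theorems.Prop7SectET3WilsonHessian (DeltaEtaSlot)
open Summit.QuantumFields.YangMills.Theorems.Prop7SectET3CurvedPropagators (GT KinvT PosOnto)
open Summit.QuantumFields.YangMills.Theorems.Prop7SectET3DeltaOnePInv (TJSlotP)
open Summit.QuantumFields.YangMills.Theorems.Prop7OneFormCoerciveHolds (hco_DeltaEtaSlot_exists posOnto_of_coercive)
open Summit.QuantumFields.YangMills.Theorems.Prop7Kernel133OfPiBlockLetters (coarseRow_mono_rate)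
open Summit.QuantumFields.YangMills.Theorems.Prop7KinvSlotOfCone (kinvRow_slot_family_of_cone)
open Summit.QuantumFields.YangMills.Theorems.Prop7KinvEtaFamilyPackage (kinvRow_eta_family_exists)
open Summit.QuantumFields.YangMills.Theorems.Prop7H133FamilyPackage (h133_family_exists)
open Summit.QuantumFields.YangMills.Theorems.Prop7GreenEtaTJBlockDecayOfLetters (hDelta_etaTJ_of_letters)
open Summit.QuantumFields.YangMills.Theorems.Prop7TJRowsFamilyOfH133 (tjValueRows_family_of_h133)
open Summit.QuantumFields.YangMills.Theorems.Prop7CoerciveDeltaOnePJOfTJSupRow (hco_DeltaEtaTJ_exists_of_tjSupLin)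
open Summit.QuantumFields.YangMills.Theorems.Prop7OneFormGreenBlockSupFamily (blockSup_GT_DeltaEtaSlot_family)
open Summit.QuantumFields.YangMills.Theorems.Prop7GreenPiBlockLettersEdition (weighted_of_blockSupported)
open Summit.QuantumFields.YangMills.Theorems.Prop7TJWeightedRowsOfUnweighted (hTw_of_supRow)

/-! ## §1 Member: the cone's `hΔb` at `S_J` from the block-supported `G₀`-value letter and the sup row of `T_Jᴾ` -/

section Member

variable (F : T3Family) {n K : ℕ} (h : n ≤ K) (c₀ cB : ℝ) [Fact (0 < c₀)] [Fact (0 < cB)]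

/-- ★★ **THE CONE's `hΔb` AT `S_J := Δ^η + T_Jᴾ` FROM THE BLOCK-SUPPORTED `G₀`-VALUE LETTER AND THE SUP ROW OF `T_Jᴾ`** (member; `U₀ ∈ 𝔘_k(ε₀)`, `10¹²L³ε₀ ≤ 1`): the (Gb) letter at
rate `δ₁` with constant `BV`, the sup row of `T_Jᴾ(U₀)` with constant `k ≥ 0`, rates `0 ≤ δ`, `0 < ν`, `δ + ν ≤ δ₁`, and the window `BV·(2(1+1∕ν))³·(k·e^{δ}) ≤ ½` give the block rows of
`(G_S − G₀)(toL2 X)` with constant `2·(BV·V)·(BV·V)·(k·e^{δ})` at rate `δ` — (F) ✓`hDelta_etaTJ_of_letters` ∘ ✓`weighted_of_blockSupported` ∘ ✓`hTw_of_supRow`.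
[cite: Balaban1985BackgroundPropagators, (3.130)–(3.132) pp.421–422, (3.137) p.423, Thm 3.12 p.423; Balaban1985Variational, (110)–(111) p.294] -/
theorem hDelta_etaTJ_of_blockLetter_of_supRow {ε₀ : ℝ} (hε₀ : 0 < ε₀) (hWε : 10 ^ 12 * (F.L : ℝ) ^ 3 * ε₀ ≤ 1)
    (U₀ : GaugeField (F.P K) 0 (Matrix.specialUnitaryGroup (Fin 2) ℂ)) (hreg : RegPr F n K ε₀ U₀) (a : ℝ)
    (hp₀ : PosOnto F n K h c₀ cB a (DeltaEtaSlot F n K c₀) U₀)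
    (hpS : PosOnto F n K h c₀ cB a (DeltaEtaSlot F n K c₀ + TJSlotP F n K h c₀ cB a) U₀)
    {BV k δ δ₁ ν : ℝ} (hBV : 0 ≤ BV) (hk : 0 ≤ k) (hδ : 0 ≤ δ) (hν : 0 < ν) (hδ₁ : δ + ν ≤ δ₁)
    (hGb : ∀ (X : PBond (F.P K) 0 → Matrix (Fin 2) (Fin 2) ℂ) (z : Site (F.P K) (K - n)), (∀ b, X b ≠ 0 → iterBlockOf (K - n) b.src = z) →
      ∀ s : ℝ, 0 ≤ s → (∀ b, ‖X b‖ ≤ s) →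
        ∀ bd : PBond (F.P K) 0, ‖(toL2 F K c₀).symm (GT F n K h c₀ cB a (DeltaEtaSlot F n K c₀) U₀ (toL2 F K c₀ X)) bd‖
          ≤ s * BV * Real.exp (-(δ₁ * (Site.tdist (P := F.P K) (iterBlockOf (K - n) bd.src) z : ℝ))))
    (hTsup : ∀ (X : PBond (F.P K) 0 → Matrix (Fin 2) (Fin 2) ℂ) (s : ℝ), (∀ bd, ‖X bd‖ ≤ s) →
      ∀ bd : PBond (F.P K) 0, ‖(toL2 F K c₀).symm (TJSlotP F n K h c₀ cB a U₀ (toL2 F K c₀ X)) bd‖ ≤ k * s)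
    (hwin : BV * (2 * (1 + 1 / ν)) ^ 3 * (k * Real.exp δ) ≤ 1 / 2) :
    ∀ (X : PBond (F.P K) 0 → Matrix (Fin 2) (Fin 2) ℂ) (z : Site (F.P K) (K - n)), (∀ b, X b ≠ 0 → iterBlockOf (K - n) b.src = z) →
      ∀ s : ℝ, 0 ≤ s → (∀ b, ‖X b‖ ≤ s) →
        ∀ bd : PBond (F.P K) 0, ‖(toL2 F K c₀).symm ((GT F n K h c₀ cB a (DeltaEtaSlot F n K c₀ + TJSlotP F n K h c₀ cB a) U₀
            - GT F n K h c₀ cB a (DeltaEtaSlot F n K c₀) U₀) (toL2 F K c₀ X)) bd‖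
          ≤ s * (2 * (BV * (2 * (1 + 1 / ν)) ^ 3) * (BV * (2 * (1 + 1 / ν)) ^ 3) * (k * Real.exp δ))
              * Real.exp (-(δ * (Site.tdist (P := F.P K) (iterBlockOf (K - n) bd.src) z : ℝ))) := by
  have hV : 0 ≤ (2 * (1 + 1 / ν)) ^ 3 := by positivity
  -- the block-supported `G₀` letter, weighted (rate loss `ν`)
  have hΦG : ∀ f : Site (F.P K) (K - n) → PBond (F.P K) 0 → Matrix (Fin 2) (Fin 2) ℂ,
      (fun X bd => (toL2 F K c₀).symm (GT F n K h c₀ cB a (DeltaEtaSlot F n K c₀) U₀ (toL2 F K c₀ X)) bd) (∑ z, f z)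
        = ∑ z, (fun X bd => (toL2 F K c₀).symm (GT F n K h c₀ cB a (DeltaEtaSlot F n K c₀) U₀ (toL2 F K c₀ X)) bd) (f z) := fun f => by
    funext bd; simp only [map_sum, Finset.sum_apply]
  have hGw := fun (z : Site (F.P K) (K - n)) (Y : PBond (F.P K) 0 → Matrix (Fin 2) (Fin 2) ℂ) (m : ℝ) (hm : 0 ≤ m)
      (hY : ∀ b, ‖Y b‖ ≤ m * Real.exp (-(δ * (Site.tdist (iterBlockOf (K - n) b.src) z : ℝ)))) (bd : PBond (F.P K) 0) =>
    weighted_of_blockSupported (fun b : PBond (F.P K) 0 => iterBlockOf (K - n) b.src) (fun bd : PBond (F.P K) 0 => iterBlockOf (K - n) bd.src) _ hΦG hBV hδ hν hδ₁ hGb z Y m hm hY bd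
  -- the sup row of `T_Jᴾ`, weighted (two-block locality)
  have hTw := hTw_of_supRow F h c₀ cB a hε₀ hWε U₀ hreg hTsup hδ
  have hCT : 0 ≤ k * Real.exp δ := by positivity
  exact hDelta_etaTJ_of_letters (TJSlotP F n K h c₀ cB a) U₀ hp₀ hpS (mul_nonneg hBV hV) hCT
    (fun z Y m hm hY bd => (hGw z Y m hm hY bd).trans (le_of_eq (by ring))) hTw hwin

end Member

/-! ## §2 Family: the `hKinv`(S_J) `∃`-package -/

section Family

/-- ★★★ **THE `hKinv`(S_J) `∃`-PACKAGE: THE COARSE ENTRY ROW OF `(Q_kG_SQ_k†)⁻¹`, `S_J = Δ^η + T_Jᴾ`, FOR ALL MEMBERS WITH L-ONLY CONSTANTS** (cap `αJ`, constant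
`CJ L·((c₀ L∕cB L)·ℓ³)`, rate `μJ L`; thread `Lift ∧ ROOM ∧` coupling window) — ✓`kinvRow_slot_family_of_cone` ∘ {✓`kinvRow_eta_family_exists`, §1 fed ✓`blockSup_GT_DeltaEtaSlot_family` and
(T1) ✓`tjValueRows_family_of_h133` ∘ ✓`h133_family_exists`, (T2) ✓`hco_DeltaEtaTJ_exists_of_tjSupLin`, (γ) ✓`hco_DeltaEtaSlot_exists`}, ONE pure-real cap closing both windows.
[cite: Balaban1985BackgroundPropagators, (3.127)–(3.132) pp.421–422, (3.137) p.423, (3.86) p.409; Balaban1985Variational, Thm 1 p.279, (28) p.282] -/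
theorem kinvRow_etaTJ_family_exists [hFL : ∀ F : T3Family, Fact (0 < (F.L : ℝ))] [hFη : ∀ (F : T3Family) (k : ℕ), Fact (0 < ((F.L : ℝ)⁻¹) ^ k)]
    (c₀ cB : ℕ → ℝ) [hc₀ : ∀ L : ℕ, Fact (0 < c₀ L)] [hcB : ∀ L : ℕ, Fact (0 < cB L)] {a₀ a₁ : ℝ} (ha₀ : 0 < a₀) (ha₀₁ : a₀ ≤ a₁) :
    ∃ (αJ CJ μJ : ℕ → ℝ),
      (∀ L : ℕ, 1 < L → 0 < αJ L) ∧ (∀ L : ℕ, 1 < L → 10 ^ 12 * (L : ℝ) ^ 3 * αJ L ≤ 1) ∧ (∀ L : ℕ, 1 < L → 10 ^ 10 * (L : ℝ) ^ 6 * αJ L ≤ 1) ∧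
      (∀ L : ℕ, 1 < L → 13 * 10 ^ 14 * (L : ℝ) ^ 3 * αJ L ≤ 1) ∧ (∀ L : ℕ, 1 < L → αJ L ≤ 1) ∧ (∀ L : ℕ, 1 < L → 0 ≤ CJ L) ∧ (∀ L : ℕ, 1 < L → 0 < μJ L) ∧
    ∀ (L : ℕ), 1 < L → ∀ (i : Idx L) (U₀ : GaugeField (i.1.1.P i.1.2.2) 0 (Matrix.specialUnitaryGroup (Fin 2) ℂ)), ∀ ρ : ℝ, RegPr i.1.1 i.1.2.1 i.1.2.2 ρ U₀ → ρ ≤ αJ L →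
        (∀ cf : Site (i.1.1.P i.1.2.2) (i.1.2.2 - i.1.2.1) → Matrix (Fin 2) (Fin 2) ℂ,
        (∀ e' : PBond (i.1.1.P i.1.2.2) (i.1.2.2 - i.1.2.1), cf e'.src = ((emlIterU (i.1.2.2 - i.1.2.1) (bgUnits i.1.1 i.1.2.2 U₀) e' : (Matrix (Fin 2) (Fin 2) ℂ)ˣ) : Matrix (Fin 2) (Fin 2) ℂ) * cf e'.tgt *
        (((emlIterU (i.1.2.2 - i.1.2.1) (bgUnits i.1.1 i.1.2.2 U₀) e')⁻¹ : (Matrix (Fin 2) (Fin 2) ℂ)ˣ) : Matrix (Fin 2) (Fin 2) ℂ)) →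
        ∃ l₀ : Site (i.1.1.P i.1.2.2) 0 → Matrix (Fin 2) (Fin 2) ℂ,
        (∀ b' : PBond (i.1.1.P i.1.2.2) 0, l₀ b'.src = ((bgUnits i.1.1 i.1.2.2 U₀ b' : (Matrix (Fin 2) (Fin 2) ℂ)ˣ) : Matrix (Fin 2) (Fin 2) ℂ) * l₀ b'.tgt * (((bgUnits i.1.1 i.1.2.2 U₀ b')⁻¹ : (Matrix (Fin 2) (Fin 2) ℂ)ˣ) : Matrix (Fin 2) (Fin 2) ℂ)) ∧
        ∀ y : Site (i.1.1.P i.1.2.2) (i.1.2.2 - i.1.2.1), l₀ (embIter (i.1.2.2 - i.1.2.1) y) = cf y) →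
      2 * (12 * i.1.1.L ^ (i.1.2.2 - i.1.2.1) + 5) ≤ (i.1.1.P i.1.2.2).sitesPerDir 0 →
      ∀ a : ℝ, a₀ * (c₀ L / cB L) * ((i.1.1.L : ℝ) ^ (i.1.2.2 - i.1.2.1)) ^ 3 ≤ a → a ≤ a₁ * (c₀ L / cB L) * ((i.1.1.L : ℝ) ^ (i.1.2.2 - i.1.2.1)) ^ 3 →
      ∀ (y : PBond (i.1.1.P i.1.2.1) 0) (Z : Matrix (Fin 2) (Fin 2) ℂ) (y' : PBond (i.1.1.P i.1.2.1) 0),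
        ‖(toL2B i.1.1 i.1.2.1 (cB L)).symm (KinvT i.1.1 i.1.2.1 i.1.2.2 i.2.2.le (c₀ L) (cB L) a
            (DeltaEtaSlot i.1.1 i.1.2.1 i.1.2.2 (c₀ L) + TJSlotP i.1.1 i.1.2.1 i.1.2.2 i.2.2.le (c₀ L) (cB L) a) U₀
            (toL2B i.1.1 i.1.2.1 (cB L) (Pi.single y Z))) y'‖
          ≤ CJ L * ((c₀ L / cB L) * ((L : ℝ) ^ (i.1.2.2 - i.1.2.1)) ^ 3)
              * Real.exp (-(μJ L * (Site.tdist (siteShift (sites_eq i.1.1 i.1.2.1 i.1.2.2 i.2.2.le) y'.src) (siteShift (sites_eq i.1.1 i.1.2.1 i.1.2.2 i.2.2.le) y.src) : ℝ))) * ‖Z‖ := by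
  classical
  -- the landed ∃-packages
  obtain ⟨αK, CK, μK, hαK, hWK12, hWK10, hWK13, hαK1, hCK, hμK, hKη⟩ := kinvRow_eta_family_exists c₀ cB ha₀ ha₀₁
  obtain ⟨αH, CH, δH, hαH, hWH12, hWH10, hWH13, _hαH1, hCH, hδH, h133⟩ := h133_family_exists c₀ cB ha₀ ha₀₁
  obtain ⟨αT, MT, hαT, hWT12, _hWT10, _hWT13, _hWT16, _hαTH, _hαT1, hMT, hT⟩ :=
    tjValueRows_family_of_h133 c₀ cB αH CH δH hαH hWH12 hWH10 hWH13 hCH hδH h133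
  obtain ⟨αc, γr, hαc, _hWc12, _hWc13, hαcT, _hγr, hcS⟩ := hco_DeltaEtaTJ_exists_of_tjSupLin c₀ cB ha₀ αT MT hαT hWT12 hMT
    (fun L hL i U₀ ρ hreg hρ hl hr a ha hb => (hT L hL i U₀ ρ hreg hρ hl hr a ha hb).1)
  obtain ⟨αG, BV, δG, hαG, _hWG12, _hWG10, _hWG13, hBV, hδG, hG⟩ := blockSup_GT_DeltaEtaSlot_family c₀ cB ha₀ ha₀₁
  obtain ⟨αco, γco, hαco, _hWco, _hwinco, hγco, hco⟩ := hco_DeltaEtaSlot_exists c₀ cB ha₀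
  -- the rates: the letters at `δ := δG∕2` (rate loss `ν := δG∕2`), the cone at `μ := min μK (δG∕4)` so that `2μ ≤ δ`
  set δ : ℕ → ℝ := fun L => δG L / 2 with hδd
  have hδ0 : ∀ L : ℕ, 1 < L → 0 ≤ δ L := fun L hL => by simp only [hδd]; exact (half_pos (hδG L hL)).le
  have hδν : ∀ L : ℕ, δ L + δG L / 2 ≤ δG L := fun L => by simp only [hδd]; linarith
  set μ : ℕ → ℝ := fun L => min (μK L) (δG L / 4) with hμd
  have hμ0 : ∀ L : ℕ, 1 < L → 0 < μ L := fun L hL => by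
    have := hδG L hL; simp only [hμd]; exact lt_min (hμK L hL) (by positivity)
  have hμK' : ∀ L : ℕ, μ L ≤ μK L := fun L => min_le_left _ _
  have hμδ : ∀ L : ℕ, 1 < L → 2 * μ L ≤ δ L := fun L hL => by have := min_le_right (μK L) (δG L / 4); simp only [hμd, hδd]; linarith
  -- the (F) window modulus `N` and the cone modulus `M` (per unit radius)
  set N : ℕ → ℝ := fun L => 2 * (BV L * (2 * (1 + 1 / (δG L / 2))) ^ 3) * (MT L * Real.exp (δ L)) with hNd
  have hN0 : ∀ L : ℕ, 1 < L → 0 ≤ N L := fun L hL => by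
    have := hBV L hL; have := hMT L hL; have := hδG L hL; simp only [hNd]; positivity
  set M : ℕ → ℝ := fun L => CK L * (9600 * Real.exp (2 * μ L + 1) * (2 * (BV L * (2 * (1 + 1 / (δG L / 2))) ^ 3) * (BV L * (2 * (1 + 1 / (δG L / 2))) ^ 3) * (MT L * Real.exp (δ L)))
    * (2 * (1 + 1 / μ L)) ^ 3) * (3 * (2 * (1 + 2 / μ L)) ^ 3) * (3 * (2 * (1 + 4 / μ L)) ^ 3) with hMd
  have hM0 : ∀ L : ℕ, 1 < L → 0 ≤ M L := fun L hL => by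
    have := hCK L hL; have := hBV L hL; have := hMT L hL; have := hδG L hL; have := hμ0 L hL; simp only [hMd]; positivity
  -- the cap
  set αJ : ℕ → ℝ := fun L => min (min (min (αK L) (αG L)) (min (αco L) (αc L))) (min (M L + 1)⁻¹ (N L + 1)⁻¹) with hαJ
  have hαJ0 : ∀ L : ℕ, 1 < L → 0 < αJ L := fun L hL => by
    have := hαK L hL; have := hαG L hL; have := hαco L hL; have := hαc L hL; have := hM0 L hL; have := hN0 L hL
    simp only [hαJ]
    exact lt_min (lt_min (lt_min (by assumption) (by assumption)) (lt_min (by assumption) (by assumption))) (lt_min (by positivity) (by positivity))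
  have hαJK : ∀ L, αJ L ≤ αK L := fun L => by simp only [hαJ]; exact (min_le_left _ _).trans ((min_le_left _ _).trans (min_le_left _ _))
  have hαJG : ∀ L, αJ L ≤ αG L := fun L => by simp only [hαJ]; exact (min_le_left _ _).trans ((min_le_left _ _).trans (min_le_right _ _))
  have hαJco : ∀ L, αJ L ≤ αco L := fun L => by simp only [hαJ]; exact (min_le_left _ _).trans ((min_le_right _ _).trans (min_le_left _ _))
  have hαJc : ∀ L, αJ L ≤ αc L := fun L => by simp only [hαJ]; exact (min_le_left _ _).trans ((min_le_right _ _).trans (min_le_right _ _))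
  have hαJT : ∀ L, 1 < L → αJ L ≤ αT L := fun L hL => (hαJc L).trans (hαcT L hL)
  have hαJM : ∀ L, αJ L ≤ (M L + 1)⁻¹ := fun L => by simp only [hαJ]; exact (min_le_right _ _).trans (min_le_left _ _)
  have hαJN : ∀ L, αJ L ≤ (N L + 1)⁻¹ := fun L => by simp only [hαJ]; exact (min_le_right _ _).trans (min_le_right _ _)
  have hW12 : ∀ L : ℕ, 1 < L → 10 ^ 12 * (L : ℝ) ^ 3 * αJ L ≤ 1 := fun L hL => by
    have hL0 : (0 : ℝ) < L := by exact_mod_cast lt_trans zero_lt_one hL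
    exact (mul_le_mul_of_nonneg_left (hαJK L) (by positivity)).trans (hWK12 L hL)
  have hW10 : ∀ L : ℕ, 1 < L → 10 ^ 10 * (L : ℝ) ^ 6 * αJ L ≤ 1 := fun L hL => by
    have hL0 : (0 : ℝ) < L := by exact_mod_cast lt_trans zero_lt_one hL
    exact (mul_le_mul_of_nonneg_left (hαJK L) (by positivity)).trans (hWK10 L hL)
  have hW13 : ∀ L : ℕ, 1 < L → 13 * 10 ^ 14 * (L : ℝ) ^ 3 * αJ L ≤ 1 := fun L hL => by
    have hL0 : (0 : ℝ) < L := by exact_mod_cast lt_trans zero_lt_one hL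
    exact (mul_le_mul_of_nonneg_left (hαJK L) (by positivity)).trans (hWK13 L hL)
  -- (F)'s window `BV·V·(αJ·MT·e^{δ}) = αJ·N∕2 ≤ ½`
  have hwinF : ∀ L : ℕ, 1 < L → BV L * (2 * (1 + 1 / (δG L / 2))) ^ 3 * (αJ L * MT L * Real.exp (δ L)) ≤ 1 / 2 := by
    intro L hL
    have hN := hN0 L hL
    have e : BV L * (2 * (1 + 1 / (δG L / 2))) ^ 3 * (αJ L * MT L * Real.exp (δ L)) = αJ L * N L / 2 := by simp only [hNd]; ring
    rw [e]
    have h1 : αJ L * N L ≤ (N L + 1)⁻¹ * N L := mul_le_mul_of_nonneg_right (hαJN L) hN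
    have h2 : (N L + 1)⁻¹ * N L < 1 := by rw [inv_mul_lt_iff₀ (by linarith)]; linarith
    linarith
  -- the cone window `αJ·M < 1`
  have hwin : ∀ L : ℕ, 1 < L → CK L * (9600 * Real.exp (2 * μ L + 1)
      * (2 * (BV L * (2 * (1 + 1 / (δG L / 2))) ^ 3) * (BV L * (2 * (1 + 1 / (δG L / 2))) ^ 3) * (αJ L * MT L * Real.exp (δ L)))
      * (2 * (1 + 1 / μ L)) ^ 3) * (3 * (2 * (1 + 2 / μ L)) ^ 3) * (3 * (2 * (1 + 4 / μ L)) ^ 3) < 1 := by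
    intro L hL
    have hM := hM0 L hL
    have e : CK L * (9600 * Real.exp (2 * μ L + 1)
        * (2 * (BV L * (2 * (1 + 1 / (δG L / 2))) ^ 3) * (BV L * (2 * (1 + 1 / (δG L / 2))) ^ 3) * (αJ L * MT L * Real.exp (δ L)))
        * (2 * (1 + 1 / μ L)) ^ 3) * (3 * (2 * (1 + 2 / μ L)) ^ 3) * (3 * (2 * (1 + 4 / μ L)) ^ 3) = αJ L * M L := by
      simp only [hMd]; ring
    rw [e]
    calc αJ L * M L ≤ (M L + 1)⁻¹ * M L := mul_le_mul_of_nonneg_right (hαJM L) hM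
      _ < 1 := by rw [inv_mul_lt_iff₀ (by linarith)]; linarith
  refine ⟨αJ, fun L => (1 / (1 - CK L * (9600 * Real.exp (2 * μ L + 1)
      * (2 * (BV L * (2 * (1 + 1 / (δG L / 2))) ^ 3) * (BV L * (2 * (1 + 1 / (δG L / 2))) ^ 3) * (αJ L * MT L * Real.exp (δ L)))
      * (2 * (1 + 1 / μ L)) ^ 3) * (3 * (2 * (1 + 2 / μ L)) ^ 3) * (3 * (2 * (1 + 4 / μ L)) ^ 3))) * CK L * (3 * (2 * (1 + 8 / μ L)) ^ 3),
    fun L => μ L / 8, hαJ0, hW12, hW10, hW13, fun L hL => (hαJK L).trans (hαK1 L hL), fun L hL => ?_, fun L hL => by have := hμ0 L hL; positivity, ?_⟩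
  · have := hCK L hL; have := hμ0 L hL; have h1 := hwin L hL
    exact mul_nonneg (mul_nonneg (div_nonneg one_pos.le (by linarith)) (hCK L hL)) (by positivity)
  intro L hL i U₀ ρ hreg hρ hlift hroom a ha₀a ha₁a y Z y'
  -- the clamped coupling function
  obtain ⟨af, haf⟩ : ∃ f : ∀ L' : ℕ, Idx L' → ℝ, ∀ (L' : ℕ) (i' : Idx L'),
      f L' i' = max (a₀ * (c₀ L' / cB L') * ((i'.1.1.L : ℝ) ^ (i'.1.2.2 - i'.1.2.1)) ^ 3) (min a (a₁ * (c₀ L' / cB L') * ((i'.1.1.L : ℝ) ^ (i'.1.2.2 - i'.1.2.1)) ^ 3)) :=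
    ⟨_, fun _ _ => rfl⟩
  have ht0 : ∀ (L' : ℕ) (i' : Idx L'), 0 ≤ (c₀ L' / cB L') * ((i'.1.1.L : ℝ) ^ (i'.1.2.2 - i'.1.2.1)) ^ 3 := fun L' i' =>
    mul_nonneg (div_nonneg (hc₀ L').out.le (hcB L').out.le) (pow_nonneg (pow_nonneg (Nat.cast_nonneg _) _) _)
  have haf_lo : ∀ (L' : ℕ) (i' : Idx L'), a₀ * (c₀ L' / cB L') * ((i'.1.1.L : ℝ) ^ (i'.1.2.2 - i'.1.2.1)) ^ 3 ≤ af L' i' := fun L' i' => by rw [haf]; exact le_max_left _ _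
  have haf_hi : ∀ (L' : ℕ) (i' : Idx L'), af L' i' ≤ a₁ * (c₀ L' / cB L') * ((i'.1.1.L : ℝ) ^ (i'.1.2.2 - i'.1.2.1)) ^ 3 := fun L' i' => by
    rw [haf]
    refine max_le ?_ (min_le_right _ _)
    have := ht0 L' i'
    rw [mul_assoc, mul_assoc]; exact mul_le_mul_of_nonneg_right ha₀₁ this
  have hafa : af L i = a := by rw [haf, min_eq_left ha₁a, max_eq_right ha₀a]
  -- the thread `Lift ∧ ROOM`
  obtain ⟨Λ, hΛ⟩ : ∃ Λ : ∀ (L' : ℕ) (i' : Idx L'), GaugeField (i'.1.1.P i'.1.2.2) 0 (Matrix.specialUnitaryGroup (Fin 2) ℂ) → Prop, ∀ L' i' U₀', Λ L' i' U₀' ↔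
      ((∀ cf : Site (i'.1.1.P i'.1.2.2) (i'.1.2.2 - i'.1.2.1) → Matrix (Fin 2) (Fin 2) ℂ,
        (∀ e' : PBond (i'.1.1.P i'.1.2.2) (i'.1.2.2 - i'.1.2.1), cf e'.src = ((emlIterU (i'.1.2.2 - i'.1.2.1) (bgUnits i'.1.1 i'.1.2.2 U₀') e' : (Matrix (Fin 2) (Fin 2) ℂ)ˣ) : Matrix (Fin 2) (Fin 2) ℂ) * cf e'.tgt *
        (((emlIterU (i'.1.2.2 - i'.1.2.1) (bgUnits i'.1.1 i'.1.2.2 U₀') e')⁻¹ : (Matrix (Fin 2) (Fin 2) ℂ)ˣ) : Matrix (Fin 2) (Fin 2) ℂ)) →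
        ∃ l₀ : Site (i'.1.1.P i'.1.2.2) 0 → Matrix (Fin 2) (Fin 2) ℂ,
        (∀ b' : PBond (i'.1.1.P i'.1.2.2) 0, l₀ b'.src = ((bgUnits i'.1.1 i'.1.2.2 U₀' b' : (Matrix (Fin 2) (Fin 2) ℂ)ˣ) : Matrix (Fin 2) (Fin 2) ℂ) * l₀ b'.tgt * (((bgUnits i'.1.1 i'.1.2.2 U₀' b')⁻¹ : (Matrix (Fin 2) (Fin 2) ℂ)ˣ) : Matrix (Fin 2) (Fin 2) ℂ)) ∧
        ∀ y : Site (i'.1.1.P i'.1.2.2) (i'.1.2.2 - i'.1.2.1), l₀ (embIter (i'.1.2.2 - i'.1.2.1) y) = cf y) ∧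
      2 * (12 * i'.1.1.L ^ (i'.1.2.2 - i'.1.2.1) + 5) ≤ (i'.1.1.P i'.1.2.2).sitesPerDir 0) := ⟨_, fun _ _ _ => Iff.rfl⟩
  -- the windows of record at each member under the cap
  have hw13 : ∀ (L' : ℕ), 1 < L' → ∀ (i' : Idx L') (ρ' : ℝ), ρ' ≤ αJ L' → 13 * 10 ^ 14 * (i'.1.1.L : ℝ) ^ 3 * ρ' ≤ 1 := by
    intro L' hL' i' ρ' hρ'
    have e : (i'.1.1.L : ℝ) = (L' : ℝ) := by rw [i'.2.1]
    have hL0 : (0 : ℝ) < L' := by exact_mod_cast lt_trans zero_lt_one hL'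
    rw [e]
    calc 13 * 10 ^ 14 * (L' : ℝ) ^ 3 * ρ' ≤ 13 * 10 ^ 14 * (L' : ℝ) ^ 3 * αJ L' := mul_le_mul_of_nonneg_left hρ' (by positivity)
      _ ≤ 1 := hW13 L' hL'
  have hw12 : ∀ (L' : ℕ), 1 < L' → ∀ (i' : Idx L'), 10 ^ 12 * (i'.1.1.L : ℝ) ^ 3 * αJ L' ≤ 1 := by
    intro L' hL' i'
    have e : (i'.1.1.L : ℝ) = (L' : ℝ) := by rw [i'.2.1]
    rw [e]; exact hW12 L' hL'
  -- the cone at the slot family `S_J`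
  have key := kinvRow_slot_family_of_cone αJ hαJ0 hW10 hW12 c₀ cB af
    (fun L' i' => DeltaEtaSlot i'.1.1 i'.1.2.1 i'.1.2.2 (c₀ L') + TJSlotP i'.1.1 i'.1.2.1 i'.1.2.2 i'.2.2.le (c₀ L') (cB L') (af L' i')) Λ
    (fun L' hL' i' U₀' ρ' hreg' hρ' hl' => posOnto_of_coercive i'.2.2.le (cB L') i'.2.2 hreg' (hw13 L' hL' i' ρ' hρ') (hγco L' hL') _
      (hco L' hL' i' U₀' ρ' hreg' (hρ'.trans (hαJco L')) ((hΛ L' i' U₀').mp hl').1 (af L' i') (haf_lo L' i')))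
    (fun L' hL' i' U₀' ρ' hreg' hρ' hl' =>
      (hcS L' hL' i' U₀' ρ' hreg' (hρ'.trans (hαJc L')) ((hΛ L' i' U₀').mp hl').1 ((hΛ L' i' U₀').mp hl').2 (af L' i') (haf_lo L' i') (haf_hi L' i')).2.1)
    CK μ (fun L' => 2 * (BV L' * (2 * (1 + 1 / (δG L' / 2))) ^ 3) * (BV L' * (2 * (1 + 1 / (δG L' / 2))) ^ 3) * (αJ L' * MT L' * Real.exp (δ L'))) δ hCK hμ0
    (fun L' hL' => by have := hBV L' hL'; have := hMT L' hL'; have := hδG L' hL'; have := (hαJ0 L' hL').le; positivity) hμδ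
    (fun L' hL' i' U₀' ρ' hreg' hρ' hl' => coarseRow_mono_rate i'.2.2.le (cB L') _
      (mul_nonneg (hCK L' hL') (by have hL0 : (0 : ℝ) < L' := Nat.cast_pos.mpr (lt_trans zero_lt_one hL'); have := (hc₀ L').out; have := (hcB L').out; positivity)) (hμK' L')
      (hKη L' hL' i' U₀' ρ' hreg' (hρ'.trans (hαJK L')) ((hΛ L' i' U₀').mp hl').1 ((hΛ L' i' U₀').mp hl').2 (af L' i') (haf_lo L' i') (haf_hi L' i')))
    (fun L' hL' i' U₀' ρ' hreg' hρ' hl' =>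
      hDelta_etaTJ_of_blockLetter_of_supRow i'.1.1 i'.2.2.le (c₀ L') (cB L') (hαJ0 L' hL') (hw12 L' hL' i') U₀' (regPr_mono (F := i'.1.1) hρ' hreg') (af L' i')
        (posOnto_of_coercive i'.2.2.le (cB L') i'.2.2 hreg' (hw13 L' hL' i' ρ' hρ') (hγco L' hL') _
          (hco L' hL' i' U₀' ρ' hreg' (hρ'.trans (hαJco L')) ((hΛ L' i' U₀').mp hl').1 (af L' i') (haf_lo L' i')))
        ((hcS L' hL' i' U₀' ρ' hreg' (hρ'.trans (hαJc L')) ((hΛ L' i' U₀').mp hl').1 ((hΛ L' i' U₀').mp hl').2 (af L' i') (haf_lo L' i') (haf_hi L' i')).2.1)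
        (hBV L' hL') (mul_nonneg (hαJ0 L' hL').le (hMT L' hL')) (hδ0 L' hL') (half_pos (hδG L' hL')) (hδν L')
        (hG L' hL' i' U₀' ρ' hreg' (hρ'.trans (hαJG L')) ((hΛ L' i' U₀').mp hl').1 (af L' i') (haf_lo L' i') (haf_hi L' i'))
        ((hT L' hL' i' U₀' ρ' hreg' (hρ'.trans (hαJT L' hL')) ((hΛ L' i' U₀').mp hl').1 ((hΛ L' i' U₀').mp hl').2 (af L' i') (haf_lo L' i') (haf_hi L' i')).1
          (αJ L') (hαJ0 L' hL').le (hαJT L' hL') (regPr_mono (F := i'.1.1) hρ' hreg'))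
        (hwinF L' hL'))
    hwin L hL i U₀ ρ hreg hρ ((hΛ L i U₀).mpr ⟨hlift, hroom⟩) y Z y'
  rw [hafa] at key
  exact key

end Family

end Summit.QuantumFields.YangMills.Theorems.Prop7KinvEtaTJFamilyPackage

end
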